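import Literature.NumberTheory.Automorphic.CongruenceTwistedAverage
import HarnessLib

/-!
# Iterated twisted column averages along `U_n(F)` at a finite level: explicit transversals,
# the projector recursion, level and Whittaker transparency

Topic `NumberTheory/Automorphic`; namespace `Literature.NumberTheory.Automorphic.WhittakerBessel`.
Definitions with bodies (`cLat`, `colCharAt`, `iterReps`, `iterAvg`) and theorems; no named fact, no
instance, no `sorry`.

Fix a uniformizer `ϖ`, an additive character `ψ` of conductor `𝒪`, exponents `1 ≤ L ≤ L₀` with
`2L ≤ L₀`, and the **scaled character** `ψ_{2L}(c) = ψ(ϖ^{-2L} c)` (`AddChar.mulShift`). For each column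
`t` of `U_n` the twisted column projector of `WhittakerColumnProjectors` with big lattice `ϖ^L 𝒪^t`,
small lattice `ϖ^{L₀} 𝒪^t` and character `ψ_{2L}(z_{t-1})` is an explicit normalised sum over the
representatives `c_t(z)`, `z ∈ R_t` running through any system of representatives of `ϖ^L 𝒪^t / ϖ^{L₀} 𝒪^t`
(hypotheses `hR`, `hRsep`, `hRcov`). Multiplying these representatives in
DECREASING order of the columns copies the entries (`colElem_mul_apply_of_isTopLeftNat`), so the products
`iterReps s = {c_{s-1}(z_{s-1}) ⋯ c_1(z_1)}` form a **left transversal of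
`U_n ∩ K(L) ∩ diag(GL_s,1)` modulo `K(L₀)`** (`isLeftTransversal_iterReps`), and the **iterated average**
`iterAvg s y = (#iterReps s)⁻¹ ∑_u ψ_{2L}(∑_i u_{i,i+1})⁻¹ ρ(u) y` satisfies the **projector recursion**
`e^{(s)} (iterAvg s y) = iterAvg (s+1) y` (`proj_iterAvg`). Consequently (`CongruenceTwistedAverage`) for a
vector `y` with lower Iwahori invariance `iterAvg s y` is the twisted average over the whole truncated
congruence subgroup `K(L)^{(s)}` (`iterAvg_eq_congTwAvg`): it is fixed by `K(2L)^{(s)}`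
(`apply_iterAvg_eq_self`) and by the lower triangular elements of `K(L)^{(s)}`
(`apply_iterAvg_eq_self_of_lower`), and `ψ_{2L}`-Whittaker functionals see through it
(`whittaker_iterAvg`). This is the uniform picture of the explicit Bessel descent at a finite level
(Jacquet–Shalika (1981), §1; Bernstein–Zelevinsky (1976), §5): conjugating by `diag(ϖ^{2Li})` turns
these averages into the graded column projectors at the standard character.

## References

* H. Jacquet, J. A. Shalika, Amer. J. Math. 103 (1981), §1 [JacquetShalikaAJM1981].
* I. N. Bernstein, A. V. Zelevinsky, Russian Math. Surveys 31:3 (1976), §2.3, §5 [BernsteinZelevinsky1976].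
-/

noncomputable section

open scoped MatrixGroups Classical
open ValuativeRel Matrix Finset

namespace Literature.NumberTheory.Automorphic

namespace WhittakerBessel

open WhittakerSupercuspidal

variable {F : Type*} [Field F] [ValuativeRel F] {n : ℕ}

/-! ### Parameters: square lattices and the scaled column character -/

omit [ValuativeRel F] in
/-- The constant exponent vector `(L, …, L)` (square lattice `ϖ^L 𝒪^t`). [folklore] -/
def cLat (n : ℕ) (L : ℤ) : Fin n → ℤ := fun _ => L

omit [ValuativeRel F] in
/-- Entries of `cLat`. [folklore] -/
@[simp] theorem cLat_apply (L : ℤ) (i : Fin n) : cLat n L i = L := rfl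

omit [ValuativeRel F] in
/-- The character parameter `b = ϖ^{-2L} e_{t-1}` of the column `t` (so that `ψ_b(z) = ψ(ϖ^{-2L} z_{t-1})`;
zero when `t = 0`). [folklore] -/
def colCharAt (ϖ : F) (L : ℤ) (t : Fin n) : Fin n → F := fun i => if (i : ℕ) + 1 = (t : ℕ) then ϖ ^ (-(2 * L)) else 0

omit [ValuativeRel F] in
/-- Entries of `colCharAt`. [folklore] -/
theorem colCharAt_apply (ϖ : F) (L : ℤ) (t i : Fin n) :
    colCharAt ϖ L t i = if (i : ℕ) + 1 = (t : ℕ) then ϖ ^ (-(2 * L)) else 0 := rfl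

omit [ValuativeRel F] in
/-- The pairing with the column character picks out the entry `z_{t-1}`:
`b · z = ϖ^{-2L} ∑_{i : i+1 = t} z_i`. [folklore] -/
theorem colCharAt_dotProduct (ϖ : F) (L : ℤ) (t : Fin n) (z : Fin n → F) :
    colCharAt ϖ L t ⬝ᵥ z = ϖ ^ (-(2 * L)) * ∑ i : Fin n, if (i : ℕ) + 1 = (t : ℕ) then z i else 0 := by
  rw [dotProduct, Finset.mul_sum]
  refine Finset.sum_congr rfl fun i _ => ?_
  rw [colCharAt_apply]; split_ifs <;> simp

/-! ### Products with a column element copy the entries -/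

omit [ValuativeRel F] in
/-- **Entries are copied**: for `u` upper unitriangular and the identity outside its top-left `t × t` corner,
`(c_t(z) u)_{ij} = u_{ij} + [i < t, j = t] z_i` (`z` supported in the rows `< t`). [folklore] -/
theorem colElem_mul_apply_of_isTopLeftNat {t : Fin n} {u : GL (Fin n) F} (hu : IsTopLeftNat (t : ℕ) (u : Matrix (Fin n) (Fin n) F))
    (z : Fin n → F) (i j : Fin n) :
    ((colElem t z * u : GL (Fin n) F) : Matrix (Fin n) (Fin n) F) i j =
      (u : Matrix (Fin n) (Fin n) F) i j + if i < t ∧ j = t then z i else 0 := by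
  rw [Units.val_mul, coe_colElem, Matrix.add_mul, Matrix.one_mul, Matrix.add_apply]
  congr 1
  rw [Matrix.mul_apply]
  -- `∑_k X_{ik} u_{kj}` with `X_{ik} = [i < t, k = t] z_i`, and the row `t` of `u` is `e_t`
  rw [Finset.sum_eq_single t (fun k _ hk => by rw [colMat_apply, if_neg (fun h => hk h.2), zero_mul])
    (fun h => absurd (Finset.mem_univ t) h), colMat_apply, hu t j (Or.inl le_rfl)]
  by_cases h : i < t
  · simp only [h, true_and]
    by_cases hj : j = t
    · subst hj; simp
    · rw [if_neg (Ne.symm hj), mul_zero, if_neg hj]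
  · simp [h]

omit [ValuativeRel F] in
/-- In particular the product is again the identity outside the top-left corner of size `t + 1`. [folklore] -/
theorem isTopLeftNat_colElem_mul {t : Fin n} {u : GL (Fin n) F} (hu : IsTopLeftNat (t : ℕ) (u : Matrix (Fin n) (Fin n) F))
    (z : Fin n → F) :
    IsTopLeftNat ((t : ℕ) + 1) ((colElem t z * u : GL (Fin n) F) : Matrix (Fin n) (Fin n) F) := by
  intro r c h
  rw [colElem_mul_apply_of_isTopLeftNat hu]
  have hrc : (t : ℕ) + 1 ≤ r ∨ (t : ℕ) + 1 ≤ c := h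
  by_cases hr : r < t
  · have hc : (t : ℕ) + 1 ≤ c := by
      rcases hrc with h | h
      · exfalso; rw [Fin.lt_def] at hr; omega
      · exact h
    have hct : c ≠ t := fun e => by rw [e] at hc; omega
    rw [if_neg (fun h => hct h.2), add_zero, hu r c (Or.inr (by omega))]
  · rw [if_neg (fun h => hr h.1), add_zero, hu r c (Or.inl (not_lt.1 hr))]

omit [ValuativeRel F] in
/-- The superdiagonal sum of the product: `sdiag(c_t(z) u) = sdiag(u) + ∑_{i+1=t} z_i`. [folklore] -/
theorem sdiagMat_colElem_mul {t : Fin n} {u : GL (Fin n) F} (hu : IsTopLeftNat (t : ℕ) (u : Matrix (Fin n) (Fin n) F))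
    (z : Fin n → F) :
    sdiagMat ((colElem t z * u : GL (Fin n) F) : Matrix (Fin n) (Fin n) F) =
      sdiagMat (u : Matrix (Fin n) (Fin n) F) + ∑ i : Fin n, if (i : ℕ) + 1 = (t : ℕ) then z i else 0 := by
  simp only [sdiagMat, colElem_mul_apply_of_isTopLeftNat hu, ← Finset.sum_add_distrib]
  refine Finset.sum_congr rfl fun i _ => ?_
  have hsplit : ∀ j : Fin n, (if (i : ℕ) + 1 = (j : ℕ) then (u : Matrix (Fin n) (Fin n) F) i j + (if i < t ∧ j = t then z i else 0) else 0) =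
      (if (i : ℕ) + 1 = (j : ℕ) then (u : Matrix (Fin n) (Fin n) F) i j else 0) +
        (if (i : ℕ) + 1 = (j : ℕ) ∧ j = t then z i else 0) := by
    intro j
    by_cases h : (i : ℕ) + 1 = (j : ℕ)
    · rw [if_pos h, if_pos h]
      by_cases hj : j = t
      · subst hj; rw [if_pos ⟨Fin.lt_def.2 (by omega), rfl⟩, if_pos ⟨h, rfl⟩]
      · rw [if_neg (fun h' => hj h'.2), if_neg (fun h' => hj h'.2)]
    · rw [if_neg h, if_neg h, if_neg (fun h' => h h'.1), add_zero]
  simp_rw [hsplit]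
  rw [Finset.sum_add_distrib]
  congr 1
  rw [Finset.sum_eq_single t (fun j _ hj => if_neg (fun h => hj h.2)) (fun h => absurd (Finset.mem_univ t) h)]
  by_cases hit : (i : ℕ) + 1 = (t : ℕ)
  · rw [if_pos ⟨hit, rfl⟩, if_pos hit]
  · rw [if_neg (fun h => hit h.1), if_neg hit]

/-! ### The representatives -/

variable (ϖ : F) (L : ℤ) (R : Fin n → Finset (Fin n → F))

/-- **The product representatives** `iterReps s = {c_{s-1}(z_{s-1}) ⋯ c_1(z_1) c_0(z_0)}` (decreasing order)
built from finite sets `R t` of column vectors (meant to be representatives of `ϖ^L 𝒪^t / ϖ^{L₀} 𝒪^t`), by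
recursion on `s`. [folklore] -/
def iterReps : ℕ → Finset (GL (Fin n) F)
  | 0 => {1}
  | s + 1 => if h : s < n then
      (iterReps s ×ˢ R ⟨s, h⟩).image fun p => colElem ⟨s, h⟩ p.2 * p.1
    else iterReps s

variable {V : Type*} [AddCommGroup V] [Module ℂ V] (ρ : Representation ℂ (GL (Fin n) F) V) (ψ : AddChar F Circle)

/-- **The iterated twisted average** `(#iterReps s)⁻¹ ∑_{u ∈ iterReps s} ψ_{2L}(∑_i u_{i,i+1})⁻¹ ρ(u) y`,
`ψ_{2L} = ψ(ϖ^{-2L} ·)`. [folklore] -/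
def iterAvg (s : ℕ) (y : V) : V :=
  (((iterReps (n := n) R s).card : ℂ))⁻¹ •
    ∑ u ∈ iterReps (n := n) R s, (congChar (ψ.mulShift (ϖ ^ (-(2 * L)))) u)⁻¹ • ρ u y

variable {ϖ L R ρ ψ}

omit [ValuativeRel F] in
/-- `iterReps 0 = {1}`. [folklore] -/
@[simp] theorem iterReps_zero : iterReps (n := n) R 0 = {1} := rfl

omit [ValuativeRel F] in
/-- The recursion for `s < n`. [folklore] -/
theorem iterReps_succ_of_lt {s : ℕ} (h : s < n) :
    iterReps (n := n) R (s + 1) = (iterReps R s ×ˢ R ⟨s, h⟩).image fun p => colElem ⟨s, h⟩ p.2 * p.1 := by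
  rw [iterReps, dif_pos h]

omit [ValuativeRel F] in
/-- The recursion stops at `s ≥ n`. [folklore] -/
theorem iterReps_succ_of_le {s : ℕ} (h : n ≤ s) : iterReps (n := n) R (s + 1) = iterReps R s := by
  rw [iterReps, dif_neg (not_lt.2 h)]

omit [ValuativeRel F] in
/-- `iterAvg 0 y = y`. [folklore] -/
@[simp] theorem iterAvg_zero (y : V) : iterAvg ϖ L R ρ ψ 0 y = y := by
  rw [iterAvg, iterReps_zero, Finset.card_singleton, Finset.sum_singleton, Nat.cast_one, inv_one, one_smul,
    congChar_one, inv_one, one_smul, map_one, Module.End.one_apply]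

/-- **Structure of the representatives**: if every `z ∈ R t` lies in `ϖ^L 𝒪^t` (rows `< t`), then every
`u ∈ iterReps s` is upper unitriangular, the identity outside the top-left `s × s` corner, with entries
`u_{ij} - δ_{ij} ∈ ϖ^L 𝒪`. [folklore] -/
theorem mem_iterReps (hR : ∀ t, ∀ z ∈ R t, z ∈ colLat ϖ t (cLat n L)) {s : ℕ} {u : GL (Fin n) F}
    (hu : u ∈ iterReps R s) :
    u ∈ upperUnitriangular (Fin n) F ∧ IsTopLeftNat s (u : Matrix (Fin n) (Fin n) F) ∧
      ∀ i j, ((u : Matrix (Fin n) (Fin n) F) i j - if i = j then 1 else 0) ∈ zBall ϖ L := by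
  induction s generalizing u with
  | zero =>
    rw [iterReps_zero, Finset.mem_singleton] at hu
    subst hu
    refine ⟨Subgroup.one_mem _, by rw [Units.val_one]; exact isTopLeftNat_one 0, fun i j => ?_⟩
    rw [Units.val_one, Matrix.one_apply, sub_self]; exact AddSubgroup.zero_mem _
  | succ s ih =>
    rcases le_or_gt n s with hs | hs
    · rw [iterReps_succ_of_le hs] at hu
      obtain ⟨h1, h2, h3⟩ := ih hu
      exact ⟨h1, h2.mono (Nat.le_succ _), h3⟩
    · rw [iterReps_succ_of_lt hs, Finset.mem_image] at hu
      obtain ⟨p, hp, rfl⟩ := hu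
      obtain ⟨hp1, hp2⟩ := Finset.mem_product.1 hp
      obtain ⟨h1, h2, h3⟩ := ih hp1
      have hzmem : p.2 ∈ colLat ϖ ⟨s, hs⟩ (cLat n L) := hR _ _ hp2
      refine ⟨Subgroup.mul_mem _ (colElem_mem_upperUnitriangular _ _) h1, ?_, fun i j => ?_⟩
      · exact isTopLeftNat_colElem_mul (t := ⟨s, hs⟩) h2 p.2
      rw [colElem_mul_apply_of_isTopLeftNat h2, add_sub_right_comm]
      refine AddSubgroup.add_mem _ (h3 i j) ?_
      split_ifs with hij
      · exact hzmem.1 i hij.1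
      · exact AddSubgroup.zero_mem _

/-! ### Matrix algebra of column elements against top-left unipotent elements -/

omit [ValuativeRel F] in
/-- **General product formula**: `(c_t(x) M)_{ij} = M_{ij} + [i < t] x_i M_{tj}`. [folklore] -/
theorem colElem_mul_apply (t : Fin n) (x : Fin n → F) (M : GL (Fin n) F) (i j : Fin n) :
    ((colElem t x * M : GL (Fin n) F) : Matrix (Fin n) (Fin n) F) i j =
      (M : Matrix (Fin n) (Fin n) F) i j + if i < t then x i * (M : Matrix (Fin n) (Fin n) F) t j else 0 := by
  rw [Units.val_mul, coe_colElem, Matrix.add_mul, Matrix.one_mul, Matrix.add_apply]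
  congr 1
  rw [Matrix.mul_apply, Finset.sum_eq_single t (fun k _ hk => by rw [colMat_apply, if_neg (fun h => hk h.2), zero_mul])
    (fun h => absurd (Finset.mem_univ t) h), colMat_apply]
  by_cases h : i < t
  · rw [if_pos ⟨h, rfl⟩, if_pos h]
  · rw [if_neg (fun h' => h h'.1), if_neg h, zero_mul]

omit [ValuativeRel F] in
/-- **Commutation past a top-left unipotent element**: `u c_t(v) = c_t(u v) u` for `u` the identity outside
its top-left `t × t` corner and `v` supported in the rows `< t`. [folklore] -/
theorem mul_colElem_of_isTopLeftNat {t : Fin n} {u : GL (Fin n) F} (hu : IsTopLeftNat (t : ℕ) (u : Matrix (Fin n) (Fin n) F))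
    {v : Fin n → F} (hv : ∀ i, ¬ i < t → v i = 0) :
    u * colElem t v = colElem t ((u : Matrix (Fin n) (Fin n) F) *ᵥ v) * u := by
  have hrow : ∀ j, (u : Matrix (Fin n) (Fin n) F) t j = if t = j then 1 else 0 := fun j => hu t j (Or.inl le_rfl)
  have huv : ∀ i, ¬ i < t → ((u : Matrix (Fin n) (Fin n) F) *ᵥ v) i = 0 := by
    intro i hi
    rw [Matrix.mulVec, dotProduct]
    refine Finset.sum_eq_zero fun k _ => ?_
    by_cases hk : k < t
    · rw [hu i k (Or.inl (not_lt.1 hi))]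
      have : i ≠ k := fun e => hi (e ▸ hk)
      rw [if_neg this, zero_mul]
    · rw [hv k hk, mul_zero]
  refine Units.ext (Matrix.ext fun i j => ?_)
  rw [colElem_mul_apply, Units.val_mul, coe_colElem, Matrix.mul_add, Matrix.mul_one, Matrix.add_apply, hrow j]
  congr 1
  rw [Matrix.mul_apply]
  by_cases hi : i < t
  · rw [if_pos hi]
    simp only [colMat_apply]
    by_cases hj : t = j
    · subst hj
      rw [if_pos rfl, mul_one, Matrix.mulVec, dotProduct]
      refine Finset.sum_congr rfl fun k _ => ?_
      by_cases hk : k < t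
      · rw [if_pos ⟨hk, rfl⟩]
      · rw [if_neg (fun h => hk h.1), hv k hk]
    · rw [if_neg hj, mul_zero]
      exact Finset.sum_eq_zero fun k _ => by rw [if_neg (fun h => hj h.2.symm), mul_zero]
  · rw [if_neg hi]
    refine Finset.sum_eq_zero fun k _ => ?_
    rw [colMat_apply]
    by_cases hk : k < t ∧ j = t
    · rw [hu i k (Or.inl (not_lt.1 hi))]
      have : i ≠ k := fun e => hi (e ▸ hk.1)
      rw [if_neg this, zero_mul]
    · rw [if_neg hk, mul_zero]

/-- Integral top-left elements preserve the column lattices (rows `< t`). [folklore] -/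
theorem mulVec_mem_colLat {t : Fin n} {u : GL (Fin n) F} (hu : ∀ i j, (u : Matrix (Fin n) (Fin n) F) i j ∈ 𝒪[F])
    (hut : IsTopLeftNat (t : ℕ) (u : Matrix (Fin n) (Fin n) F)) {a : ℤ} {w : Fin n → F} (hw : w ∈ colLat ϖ t (cLat n a)) :
    (u : Matrix (Fin n) (Fin n) F) *ᵥ w ∈ colLat ϖ t (cLat n a) := by
  refine ⟨fun i _ => ?_, fun i hi => ?_⟩
  · rw [Matrix.mulVec, dotProduct, mem_zBall_iff, cLat_apply]
    refine Valuation.map_sum_le _ fun k _ => ?_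
    rw [map_mul]
    by_cases hk : k < t
    · have h1 := mem_zBall_iff.1 (hw.1 k hk)
      rw [cLat_apply] at h1
      simpa using mul_le_mul' ((Valuation.mem_integer_iff _ _).1 (hu i k)) h1
    · rw [hw.2 k hk, map_zero, mul_zero]; exact zero_le
  · rw [Matrix.mulVec, dotProduct]
    refine Finset.sum_eq_zero fun k _ => ?_
    by_cases hk : k < t
    · rw [hut i k (Or.inl (not_lt.1 hi))]
      have : i ≠ k := fun e => hi (e ▸ hk)
      rw [if_neg this, zero_mul]
    · rw [hw.2 k hk, mul_zero]

/-- Entries of an element of `iterReps` are integral (when `L ≥ 0`). [folklore] -/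
theorem apply_mem_integer_of_mem_iterReps (hL : 0 ≤ L) (hR : ∀ t, ∀ z ∈ R t, z ∈ colLat ϖ t (cLat n L))
    (hϖ1 : valuation F ϖ ≤ 1) {s : ℕ} {u : GL (Fin n) F} (hu : u ∈ iterReps R s) (i j : Fin n) :
    (u : Matrix (Fin n) (Fin n) F) i j ∈ 𝒪[F] := by
  obtain ⟨-, -, h3⟩ := mem_iterReps hR hu
  have h := mem_zBall_iff.1 (h3 i j)
  have hL1 : valuation F (ϖ ^ L) ≤ 1 := by
    obtain ⟨m, rfl⟩ := Int.eq_ofNat_of_zero_le hL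
    rw [zpow_natCast, map_pow]; exact pow_le_one' hϖ1 _
  rw [Valuation.mem_integer_iff]
  have e : (u : Matrix (Fin n) (Fin n) F) i j = ((u : Matrix (Fin n) (Fin n) F) i j - if i = j then 1 else 0) + if i = j then 1 else 0 := by
    ring
  rw [e]
  refine (Valuation.map_add_le_max' _ _ _).trans (max_le (h.trans hL1) ?_)
  split_ifs <;> simp

/-! ### Injectivity and cardinality of the product representatives -/

omit [ValuativeRel F] in
/-- The product map `(u, z) ↦ c_s(z) u` is injective on `iterReps s × R_s` (the new column is copied). [folklore] -/
theorem injOn_colElem_mul {s : ℕ} (hs : s < n) (hRt : ∀ z ∈ R ⟨s, hs⟩, ∀ i : Fin n, ¬ i < (⟨s, hs⟩ : Fin n) → z i = 0)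
    (hU : ∀ u ∈ iterReps R s, IsTopLeftNat s ((u : GL (Fin n) F) : Matrix (Fin n) (Fin n) F)) :
    Set.InjOn (fun p : GL (Fin n) F × (Fin n → F) => colElem ⟨s, hs⟩ p.2 * p.1)
      ((iterReps R s ×ˢ R ⟨s, hs⟩ : Finset _) : Set (GL (Fin n) F × (Fin n → F))) := by
  intro p hp p' hp' h
  beta_reduce at h
  rw [Finset.coe_product] at hp hp'
  set t : Fin n := ⟨s, hs⟩ with ht
  have hcol : ∀ (u : GL (Fin n) F), IsTopLeftNat s ((u : GL (Fin n) F) : Matrix (Fin n) (Fin n) F) →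
      ∀ i, i < t → (u : Matrix (Fin n) (Fin n) F) i t = 0 := by
    intro u hu i hi
    rw [hu i t (Or.inr (le_refl _)), if_neg (ne_of_lt hi)]
  have hz : p.2 = p'.2 := by
    funext i
    by_cases hi : i < t
    · have e := congrArg (fun g : GL (Fin n) F => (g : Matrix (Fin n) (Fin n) F) i t) h
      rw [colElem_mul_apply_of_isTopLeftNat (hU _ hp.1), colElem_mul_apply_of_isTopLeftNat (hU _ hp'.1),
        hcol _ (hU _ hp.1) i hi, hcol _ (hU _ hp'.1) i hi, if_pos ⟨hi, rfl⟩, if_pos ⟨hi, rfl⟩] at e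
      simpa using e
    · rw [hRt _ hp.2 i hi, hRt _ hp'.2 i hi]
  have hu : p.1 = p'.1 := by
    have e : colElem t p.2 * p.1 = colElem t p.2 * p'.1 := by rw [h]; simp only [hz]
    exact mul_left_cancel e
  exact Prod.ext hu hz

omit [ValuativeRel F] in
/-- **Cardinality**: `#iterReps (s+1) = #iterReps s · #R_s` for `s < n`. [folklore] -/
theorem card_iterReps_succ {s : ℕ} (hs : s < n) (hRt : ∀ z ∈ R ⟨s, hs⟩, ∀ i : Fin n, ¬ i < (⟨s, hs⟩ : Fin n) → z i = 0)
    (hU : ∀ u ∈ iterReps R s, IsTopLeftNat s ((u : GL (Fin n) F) : Matrix (Fin n) (Fin n) F)) :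
    (iterReps R (s + 1)).card = (iterReps R s).card * (R ⟨s, hs⟩).card := by
  rw [iterReps_succ_of_lt hs, Finset.card_image_of_injOn (injOn_colElem_mul hs hRt hU), Finset.card_product]

/-! ### The product representatives form a transversal -/

section Transversal

variable (hϖ : IsUniformizingElement ϖ) {L₀ : ℤ} (hL : 1 ≤ L) (hLL₀ : L ≤ L₀)
  (hR : ∀ t, ∀ z ∈ R t, z ∈ colLat ϖ t (cLat n L))
  (hRsep : ∀ t, ∀ z ∈ R t, ∀ z' ∈ R t, z' - z ∈ colLat ϖ t (cLat n L₀) → z = z')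
  (hRcov : ∀ t, ∀ w ∈ colLat ϖ t (cLat n L), ∃ z ∈ R t, w - z ∈ colLat ϖ t (cLat n L₀))
include hϖ hL hLL₀ hR hRsep hRcov

omit hLL₀ hR hRsep hRcov in
/-- `|ϖ^L| < 1`. [folklore] -/
theorem valuation_zpow_lt_one : valuation F (ϖ ^ L) < 1 := by
  obtain ⟨m, rfl⟩ := Int.eq_ofNat_of_zero_le (by omega : (0 : ℤ) ≤ L)
  rw [zpow_natCast, map_pow]
  exact pow_lt_one' hϖ.valuation_lt_one (by omega)

omit hLL₀ hRsep hRcov in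
/-- Elements of `iterReps s` lie in `K(L)^{(s)} ∩ U_n`. [folklore] -/
theorem iterReps_mem_congruenceTL {s : ℕ} {u : GL (Fin n) F} (hu : u ∈ iterReps R s) :
    u ∈ congruenceTL F n (valuation F (ϖ ^ L)) s ⊓ upperUnitriangular (Fin n) F := by
  obtain ⟨h1, h2, h3⟩ := mem_iterReps hR hu
  refine ⟨⟨mem_congruenceGL_of_valBound_sub_one (valuation_zpow_lt_one hϖ hL) fun i j => ?_, h2⟩, h1⟩
  rw [Matrix.sub_apply, Matrix.one_apply]
  exact mem_zBall_iff.1 (h3 i j)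

/-- **The product representatives form a left transversal of `K(L)^{(s)} ∩ U_n` modulo `K(L₀)`.** [folklore] -/
theorem isLeftTransversal_iterReps (s : ℕ) :
    IsLeftTransversal (congruenceTL F n (valuation F (ϖ ^ L)) s ⊓ upperUnitriangular (Fin n) F)
      ((congruenceTL F n (valuation F (ϖ ^ L)) s ⊓ upperUnitriangular (Fin n) F) ⊓ congruenceGL n (valuation F (ϖ ^ L₀)))
      (iterReps R s) := by
  set γ := valuation F (ϖ ^ L) with hγ
  set γ₀ := valuation F (ϖ ^ L₀) with hγ₀
  have hγ1 : γ < 1 := valuation_zpow_lt_one hϖ hL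
  have hγ₀1 : γ₀ ≤ 1 := by
    obtain ⟨m, hm⟩ := Int.eq_ofNat_of_zero_le (by omega : (0 : ℤ) ≤ L₀)
    rw [hγ₀, hm, zpow_natCast, map_pow]; exact pow_le_one' hϖ.valuation_le_one _
  have hRt : ∀ t, ∀ z ∈ R t, ∀ i : Fin n, ¬ i < t → z i = 0 := fun t z hz i hi => (hR t z hz).2 i hi
  induction s with
  | zero =>
    refine ⟨fun x hx => ?_, fun g hg => ?_⟩
    · rw [iterReps_zero, Finset.mem_singleton] at hx; subst hx; exact Subgroup.one_mem _
    · have hg1 : g = 1 := Units.ext (by rw [(hg.1.2).eq_one_of_zero, Units.val_one])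
      refine ⟨1, ⟨by rw [iterReps_zero, Finset.mem_singleton], ?_⟩, fun r ⟨hr, _⟩ => ?_⟩
      · rw [inv_one, one_mul, hg1]; exact Subgroup.one_mem _
      · rw [iterReps_zero, Finset.mem_singleton] at hr; exact hr
  | succ s ih =>
    rcases le_or_gt n s with hs | hs
    · -- vacuous step: the groups and the representatives do not change
      have hgrp : congruenceTL F n γ (s + 1) = congruenceTL F n γ s := by
        rw [congruenceTL, congruenceTL, topLeftGL_eq_top hs, topLeftGL_eq_top (by omega)]
      rw [iterReps_succ_of_le hs, hgrp]; exact ih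
    set t : Fin n := ⟨s, hs⟩ with ht
    have hU : ∀ u ∈ iterReps R s, IsTopLeftNat s ((u : GL (Fin n) F) : Matrix (Fin n) (Fin n) F) := fun u hu => (mem_iterReps hR hu).2.1
    refine ⟨fun x hx => iterReps_mem_congruenceTL hϖ hL hR hx, fun g hg => ?_⟩
    obtain ⟨⟨hgK, hgtl⟩, hgU⟩ := hg
    have hgtl' : IsTopLeftNat (s + 1) (g : Matrix (Fin n) (Fin n) F) := hgtl
    have hgU' := (mem_unipotentRadicalGL_iff_apply g).1 hgU
    -- the row `t` of `g` is `e_t`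
    have hrow : ∀ j, (g : Matrix (Fin n) (Fin n) F) t j = if t = j then 1 else 0 := by
      intro j
      rcases lt_trichotomy j t with hj | rfl | hj
      · rw [hgU' t j hj.le, Matrix.one_apply]
      · rw [hgU' t t le_rfl, Matrix.one_apply]
      · rw [hgtl' t j (Or.inr (by rw [Fin.lt_def] at hj; exact hj)), if_neg (ne_of_lt hj)]
    -- peel the column `t`: `g = c_t(z) g'`
    set z : Fin n → F := fun i => if i < t then (g : Matrix (Fin n) (Fin n) F) i t else 0 with hz
    have hzL : z ∈ colLat ϖ t (cLat n L) := by
      refine ⟨fun i hi => ?_, fun i hi => by rw [hz]; exact if_neg hi⟩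
      simp only [hz, if_pos hi, mem_zBall_iff, cLat_apply]
      have := hgK.2.1 i t
      rwa [Matrix.sub_apply, Matrix.one_apply_ne (ne_of_lt hi), sub_zero] at this
    set g' : GL (Fin n) F := colElem t (-z) * g with hg'
    have hg'entry : ∀ i j, (g' : Matrix (Fin n) (Fin n) F) i j =
        if i < t ∧ j = t then 0 else (g : Matrix (Fin n) (Fin n) F) i j := by
      intro i j
      rw [hg', colElem_mul_apply, hrow j]
      by_cases hi : i < t
      · rw [if_pos hi]
        by_cases hj : j = t
        · subst hj; rw [if_pos rfl, if_pos ⟨hi, rfl⟩, mul_one, hz]; simp [hi]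
        · rw [if_neg (Ne.symm hj), mul_zero, add_zero, if_neg (fun h => hj h.2)]
      · rw [if_neg hi, add_zero, if_neg (fun h => hi h.1)]
    have hg'tl : IsTopLeftNat s (g' : Matrix (Fin n) (Fin n) F) := by
      intro r c hrc
      rw [hg'entry]
      by_cases hr : r < t
      · have hr' : (r : ℕ) < s := by rw [Fin.lt_def] at hr; exact hr
        have hc : s ≤ (c : ℕ) := by rcases hrc with h | h <;> omega
        by_cases hct : c = t
        · rw [if_pos ⟨hr, hct⟩, if_neg]; rintro rfl; rw [hct] at hr; exact lt_irrefl _ hr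
        · have hcs : (c : ℕ) ≠ s := fun e => hct (Fin.ext e)
          rw [if_neg (fun h => hct h.2), hgtl' r c (Or.inr (by omega))]
      · rw [if_neg (fun h => hr h.1)]
        rcases (not_lt.1 hr).lt_or_eq with hr' | hr'
        · exact hgtl' r c (Or.inl (by rw [Fin.lt_def] at hr'; exact hr'))
        · rw [← hr']; exact hrow c
    have hg'U : g' ∈ upperUnitriangular (Fin n) F := Subgroup.mul_mem _ (colElem_mem_upperUnitriangular _ _) hgU
    have hg'K : g' ∈ congruenceGL n γ := by
      refine mem_congruenceGL_of_valBound_sub_one hγ1 fun i j => ?_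
      rw [Matrix.sub_apply, hg'entry]
      split_ifs with h
      · rw [Matrix.one_apply_ne (ne_of_lt (h.2 ▸ h.1)), sub_zero, map_zero]; exact zero_le
      · have := hgK.2.1 i j; rwa [Matrix.sub_apply] at this
    have hg'mem : g' ∈ congruenceTL F n γ s ⊓ upperUnitriangular (Fin n) F := ⟨⟨hg'K, hg'tl⟩, hg'U⟩
    -- the representative of `g'` and of `z`
    obtain ⟨u, ⟨hu, hug'⟩, huniq⟩ := ih.existsUnique g' hg'mem
    obtain ⟨z₀, hz₀, hzz₀⟩ := hRcov t z hzL
    have hutl : IsTopLeftNat s ((u : GL (Fin n) F) : Matrix (Fin n) (Fin n) F) := hU u hu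
    have huint : ∀ i j, (u : Matrix (Fin n) (Fin n) F) i j ∈ 𝒪[F] :=
      apply_mem_integer_of_mem_iterReps (by omega) hR hϖ.valuation_le_one hu
    have huinv_int : ∀ i j, ((u⁻¹ : GL (Fin n) F) : Matrix (Fin n) (Fin n) F) i j ∈ 𝒪[F] := fun i j =>
      (mem_glInt_iff u).1 (congruenceGL_le_glInt _ (iterReps_mem_congruenceTL hϖ hL hR hu).1.1) |>.2 i j
    have huinv_tl : IsTopLeftNat s ((u⁻¹ : GL (Fin n) F) : Matrix (Fin n) (Fin n) F) := hutl.inv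
    have hgeq : g = colElem t z * g' := by rw [hg', ← mul_assoc, ← colElem_add, add_neg_cancel, colElem_zero, one_mul]
    refine ⟨colElem t z₀ * u, ⟨?_, ?_⟩, ?_⟩
    · rw [iterReps_succ_of_lt hs, Finset.mem_image]
      exact ⟨(u, z₀), Finset.mem_product.2 ⟨hu, hz₀⟩, rfl⟩
    · -- `(c(z₀) u)⁻¹ g = c(u⁻¹ (z - z₀)) (u⁻¹ g') ∈ K(L₀)`
      have hmem₁ : colElem t z₀ * u ∈ congruenceTL F n γ (s + 1) ⊓ upperUnitriangular (Fin n) F := by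
        have : colElem t z₀ * u ∈ iterReps R (s + 1) := by
          rw [iterReps_succ_of_lt hs, Finset.mem_image]; exact ⟨(u, z₀), Finset.mem_product.2 ⟨hu, hz₀⟩, rfl⟩
        exact iterReps_mem_congruenceTL hϖ hL hR this
      refine ⟨Subgroup.mul_mem _ (Subgroup.inv_mem _ hmem₁) ⟨⟨hgK, hgtl⟩, hgU⟩, ?_⟩
      have hw : z - z₀ ∈ colLat ϖ t (cLat n L₀) := hzz₀
      have e : (colElem t z₀ * u)⁻¹ * g = colElem t (((u⁻¹ : GL (Fin n) F) : Matrix (Fin n) (Fin n) F) *ᵥ (z - z₀)) * (u⁻¹ * g') := by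
        rw [hgeq, _root_.mul_inv_rev, mul_assoc u⁻¹, ← mul_assoc (colElem t z₀)⁻¹, colElem_inv, ← colElem_add,
          show -z₀ + z = z - z₀ by abel, ← mul_assoc, mul_colElem_of_isTopLeftNat huinv_tl (fun i hi => by
            rw [Pi.sub_apply, (hzL.2 i hi), (hR t z₀ hz₀).2 i hi, sub_zero]), mul_assoc]
      rw [e]
      exact Subgroup.mul_mem _ (colElem_mem_congruenceGL hγ₀1 fun i hi => by
        have := (mulVec_mem_colLat huinv_int huinv_tl hw).1 i hi
        rwa [mem_zBall_iff, cLat_apply] at this) hug'.2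
    · -- uniqueness
      rintro r ⟨hr, hrK⟩
      rw [iterReps_succ_of_lt hs, Finset.mem_image] at hr
      obtain ⟨p, hp, rfl⟩ := hr
      obtain ⟨hp1, hp2⟩ := Finset.mem_product.1 hp
      -- compare with the candidate: `x := (c(z₀) u)⁻¹ (c(p.2) p.1) ∈ K(L₀)`
      have hcand : (colElem t z₀ * u)⁻¹ * g ∈ congruenceGL n γ₀ := by
        -- re-derive from the existence part (same computation)
        have hw : z - z₀ ∈ colLat ϖ t (cLat n L₀) := hzz₀
        have e : (colElem t z₀ * u)⁻¹ * g = colElem t (((u⁻¹ : GL (Fin n) F) : Matrix (Fin n) (Fin n) F) *ᵥ (z - z₀)) * (u⁻¹ * g') := by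
          rw [hgeq, _root_.mul_inv_rev, mul_assoc u⁻¹, ← mul_assoc (colElem t z₀)⁻¹, colElem_inv, ← colElem_add,
            show -z₀ + z = z - z₀ by abel, ← mul_assoc, mul_colElem_of_isTopLeftNat huinv_tl (fun i hi => by
              rw [Pi.sub_apply, (hzL.2 i hi), (hR t z₀ hz₀).2 i hi, sub_zero]), mul_assoc]
        rw [e]
        exact Subgroup.mul_mem _ (colElem_mem_congruenceGL hγ₀1 fun i hi => by
          have := (mulVec_mem_colLat huinv_int huinv_tl hw).1 i hi
          rwa [mem_zBall_iff, cLat_apply] at this) hug'.2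
      have hx : (colElem t z₀ * u)⁻¹ * (colElem t p.2 * p.1) ∈ congruenceGL n γ₀ := by
        have : (colElem t z₀ * u)⁻¹ * (colElem t p.2 * p.1) = ((colElem t z₀ * u)⁻¹ * g) * ((colElem t p.2 * p.1)⁻¹ * g)⁻¹ := by group
        rw [this]; exact Subgroup.mul_mem _ hcand (Subgroup.inv_mem _ hrK.2)
      have hp1tl : IsTopLeftNat s ((p.1 : GL (Fin n) F) : Matrix (Fin n) (Fin n) F) := hU _ hp1
      -- `x = c(u⁻¹ (p.2 - z₀)) (u⁻¹ p.1)`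
      have hsupp : ∀ i, ¬ i < t → (p.2 - z₀) i = 0 := fun i hi => by
        rw [Pi.sub_apply, (hR t _ hp2).2 i hi, (hR t z₀ hz₀).2 i hi, sub_zero]
      have ex : (colElem t z₀ * u)⁻¹ * (colElem t p.2 * p.1) =
          colElem t (((u⁻¹ : GL (Fin n) F) : Matrix (Fin n) (Fin n) F) *ᵥ (p.2 - z₀)) * (u⁻¹ * p.1) := by
        rw [_root_.mul_inv_rev, mul_assoc u⁻¹, ← mul_assoc (colElem t z₀)⁻¹, colElem_inv, ← colElem_add,
          show -z₀ + p.2 = p.2 - z₀ by abel, ← mul_assoc, mul_colElem_of_isTopLeftNat huinv_tl hsupp, mul_assoc]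
      -- the column `t` of `x` above the diagonal is `u⁻¹ (p.2 - z₀)`, and it is small
      have hvtl : IsTopLeftNat s ((u⁻¹ * p.1 : GL (Fin n) F) : Matrix (Fin n) (Fin n) F) := by
        rw [Units.val_mul]; exact huinv_tl.mul hp1tl
      have hcol : ∀ i, i < t → (((u⁻¹ : GL (Fin n) F) : Matrix (Fin n) (Fin n) F) *ᵥ (p.2 - z₀)) i ∈ zBall ϖ L₀ := by
        intro i hi
        have e := hx.2.1 i t
        rw [ex, Matrix.sub_apply, colElem_mul_apply_of_isTopLeftNat hvtl, hvtl i t (Or.inr le_rfl), if_neg (ne_of_lt hi),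
          if_pos ⟨hi, rfl⟩, Matrix.one_apply_ne (ne_of_lt hi), zero_add, sub_zero] at e
        exact mem_zBall_iff.2 e
      have hdiff : p.2 - z₀ ∈ colLat ϖ t (cLat n L₀) := by
        have h1 : ((u⁻¹ : GL (Fin n) F) : Matrix (Fin n) (Fin n) F) *ᵥ (p.2 - z₀) ∈ colLat ϖ t (cLat n L₀) :=
          ⟨fun i hi => by rw [cLat_apply]; exact hcol i hi, fun i hi => by
            rw [Matrix.mulVec, dotProduct]
            refine Finset.sum_eq_zero fun k _ => ?_
            by_cases hk : k < t
            · rw [huinv_tl i k (Or.inl (not_lt.1 hi))]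
              have : i ≠ k := fun e => hi (e ▸ hk)
              rw [if_neg this, zero_mul]
            · rw [hsupp k hk, mul_zero]⟩
        have h2 := mulVec_mem_colLat huint hutl h1
        rwa [Matrix.mulVec_mulVec, ← Units.val_mul, mul_inv_cancel, Units.val_one, Matrix.one_mulVec] at h2
      have hz₀eq : z₀ = p.2 := hRsep t z₀ hz₀ p.2 hp2 hdiff
      -- then `u⁻¹ p.1 ∈ K(L₀)` and the induction hypothesis gives `p.1 = u`
      have hup : u⁻¹ * p.1 ∈ congruenceGL n γ₀ := by
        have : u⁻¹ * p.1 = (colElem t z₀ * u)⁻¹ * (colElem t p.2 * p.1) := by rw [← hz₀eq]; group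
        rw [this]; exact hx
      have hp1g' : p.1⁻¹ * g' ∈ (congruenceTL F n γ s ⊓ upperUnitriangular (Fin n) F) ⊓ congruenceGL n γ₀ := by
        refine ⟨Subgroup.mul_mem _ (Subgroup.inv_mem _ (iterReps_mem_congruenceTL hϖ hL hR hp1)) hg'mem, ?_⟩
        have : p.1⁻¹ * g' = (u⁻¹ * p.1)⁻¹ * (u⁻¹ * g') := by group
        rw [this]; exact Subgroup.mul_mem _ (Subgroup.inv_mem _ hup) hug'.2
      have := huniq p.1 ⟨hp1, hp1g'⟩
      rw [this, ← hz₀eq]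

end Transversal

/-! ### The character identity -/

omit [ValuativeRel F] in
/-- **`ψ_b(-z) χ̃(u)⁻¹ = χ̃(c_t(z) u)⁻¹`** for the scaled character `χ = ψ_{2L}`, `b = ϖ^{-2L} e_{t-1}` and `u` the
identity outside its top-left `t × t` corner (the superdiagonal entries are copied). [folklore] -/
theorem cpair_neg_mul_congChar_inv {t : Fin n} {u : GL (Fin n) F}
    (hu : IsTopLeftNat (t : ℕ) (u : Matrix (Fin n) (Fin n) F)) (z : Fin n → F) :
    cpair ψ (colCharAt ϖ L t) (-z) * (congChar (ψ.mulShift (ϖ ^ (-(2 * L)))) u)⁻¹ =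
      (congChar (ψ.mulShift (ϖ ^ (-(2 * L)))) (colElem t z * u))⁻¹ := by
  rw [cpair_neg_right, ← mul_inv]
  congr 1
  simp only [congChar, cpair_apply, sdiagMat_colElem_mul hu, AddChar.map_add_eq_mul, Circle.coe_mul,
    colCharAt_dotProduct, AddChar.mulShift_apply]
  rw [mul_comm]

/-- The scaled character `ψ_{2L}` is trivial on the ball of radius `|ϖ^L|²`. [folklore] -/
theorem mulShift_eq_one_of_le (hϖ0 : ϖ ≠ 0) (hψ : ∀ c ∈ 𝒪[F], ψ c = 1) {c : F}
    (hc : valuation F c ≤ valuation F (ϖ ^ L) * valuation F (ϖ ^ L)) : ψ.mulShift (ϖ ^ (-(2 * L))) c = 1 := by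
  have h2 : valuation F (ϖ ^ L) * valuation F (ϖ ^ L) = valuation F (ϖ ^ (2 * L)) := by
    rw [← map_mul, ← zpow_add₀ hϖ0, two_mul]
  rw [h2] at hc
  rw [AddChar.mulShift_apply]
  refine hψ _ ((Valuation.mem_integer_iff _ _).2 ?_)
  rw [map_mul]
  calc valuation F (ϖ ^ (-(2 * L))) * valuation F c
      ≤ valuation F (ϖ ^ (-(2 * L))) * valuation F (ϖ ^ (2 * L)) := by gcongr
    _ = 1 := by rw [← map_mul, ← zpow_add₀ hϖ0, neg_add_cancel, zpow_zero, map_one]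

/-- `|ϖ^L|² = |ϖ^{2L}|`. [folklore] -/
theorem valuation_zpow_mul_self (hϖ0 : ϖ ≠ 0) :
    valuation F (ϖ ^ L) * valuation F (ϖ ^ L) = valuation F (ϖ ^ (2 * L)) := by
  rw [← map_mul, ← zpow_add₀ hϖ0, two_mul]

/-! ### The projector recursion, the level and the Whittaker transparency -/

section Recursion

variable {L₀ : ℤ} {y : V}

/-- The small column lattice fixes `ρ(u) y` for `u ∈ iterReps s` (`u⁻¹ c_t(x) u ∈ K(L₀)`). [folklore] -/
theorem apply_colElem_apply_of_mem_iterReps (hϖ : IsUniformizingElement ϖ) (hL : 1 ≤ L) (h2L : 2 * L ≤ L₀)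
    (hR : ∀ t, ∀ z ∈ R t, z ∈ colLat ϖ t (cLat n L))
    (hy0 : ∀ g ∈ congruenceGL n (valuation F (ϖ ^ L₀)), ρ g y = y)
    {s : ℕ} {u : GL (Fin n) F} (hu : u ∈ iterReps R s) {t : Fin n}
    {x : Fin n → F} (hx : x ∈ colLat ϖ t (cLat n L₀)) : ρ (colElem t x) (ρ u y) = ρ u y := by
  have hγ₀1 : valuation F (ϖ ^ L₀) ≤ 1 := by
    obtain ⟨m, hm⟩ := Int.eq_ofNat_of_zero_le (by omega : (0 : ℤ) ≤ L₀)
    rw [hm, zpow_natCast, map_pow]; exact pow_le_one' hϖ.valuation_le_one _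
  have hc : colElem t x ∈ congruenceGL n (valuation F (ϖ ^ L₀)) :=
    colElem_mem_congruenceGL hγ₀1 fun i hi => by
      have := hx.1 i hi
      rwa [mem_zBall_iff, cLat_apply] at this
  have huO : u ∈ glInt n F := congruenceGL_le_glInt _ (iterReps_mem_congruenceTL hϖ hL hR hu).1.1
  have hk := conj_mem_congruenceGL (Subgroup.inv_mem _ huO) hc
  rw [inv_inv] at hk
  calc ρ (colElem t x) (ρ u y) = ρ (u * (u⁻¹ * colElem t x * u)) y := by
        rw [← Module.End.mul_apply, ← map_mul]; congr 2; group
    _ = ρ u y := by rw [map_mul, Module.End.mul_apply, hy0 _ hk]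

/-- **Admissibility**: the small lattice `ϖ^{L₀} 𝒪^t` (`2L ≤ L₀`) is admissible for the column-`t` average of
`iterAvg s y` against `ψ_{2L}(z_{t-1})`. [folklore] -/
theorem isAdm_iterAvg (hϖ : IsUniformizingElement ϖ) (hL : 1 ≤ L) (h2L : 2 * L ≤ L₀)
    (hR : ∀ t, ∀ z ∈ R t, z ∈ colLat ϖ t (cLat n L))
    (hy0 : ∀ g ∈ congruenceGL n (valuation F (ϖ ^ L₀)), ρ g y = y) (s : ℕ) (t : Fin n) :
    IsAdm ρ ψ ϖ t (cLat n L) (cLat n L₀) (colCharAt ϖ L t) (iterAvg ϖ L R ρ ψ s y) where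
  le i _ := by simp only [cLat_apply]; omega
  fix x hx := by
    rw [iterAvg, map_smul, map_sum]
    congr 1
    refine Finset.sum_congr rfl fun u hu => ?_
    rw [map_smul, apply_colElem_apply_of_mem_iterReps hϖ hL h2L hR hy0 hu hx]
  triv i _ := by
    rw [colCharAt_apply, cLat_apply]
    split_ifs
    · exact mem_zBall_iff.2 (valuation_zpow_le_of_le hϖ.ne_zero hϖ.valuation_le_one (by omega))
    · exact AddSubgroup.zero_mem _

/-- **The representatives `R_t` enumerate `ϖ^L 𝒪^t / ϖ^{L₀} 𝒪^t` bijectively.** [folklore] -/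
theorem bijective_mk (hR : ∀ t, ∀ z ∈ R t, z ∈ colLat ϖ t (cLat n L))
    (hRsep : ∀ t, ∀ z ∈ R t, ∀ z' ∈ R t, z' - z ∈ colLat ϖ t (cLat n L₀) → z = z')
    (hRcov : ∀ t, ∀ w ∈ colLat ϖ t (cLat n L), ∃ z ∈ R t, w - z ∈ colLat ϖ t (cLat n L₀)) (t : Fin n) :
    Function.Bijective fun j : ↥(R t) =>
      (QuotientAddGroup.mk (⟨(j : Fin n → F), hR t j j.2⟩ : colLat ϖ t (cLat n L)) : LQ ϖ t (cLat n L) (cLat n L₀)) := by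
  constructor
  · intro j j' h
    have h' := QuotientAddGroup.eq.1 h
    rw [AddSubgroup.mem_addSubgroupOf] at h'
    have hd : (j' : Fin n → F) - j ∈ colLat ϖ t (cLat n L₀) := by
      have e : (j' : Fin n → F) - j =
          ((-(⟨(j : Fin n → F), hR t j j.2⟩ : colLat ϖ t (cLat n L)) + ⟨(j' : Fin n → F), hR t j' j'.2⟩ :
            colLat ϖ t (cLat n L)) : Fin n → F) := by
        rw [AddSubgroup.coe_add, AddSubgroup.coe_neg]; abel
      rw [e]; exact h'
    exact Subtype.ext (hRsep t _ j.2 _ j'.2 hd)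
  · intro q
    obtain ⟨z₀, hz₀, hw⟩ := hRcov t _ (q.out : colLat ϖ t (cLat n L)).2
    refine ⟨⟨z₀, hz₀⟩, (QuotientAddGroup.eq.2 ?_).trans (QuotientAddGroup.out_eq' q)⟩
    rw [AddSubgroup.mem_addSubgroupOf]
    have e : ((-(⟨z₀, hR t z₀ hz₀⟩ : colLat ϖ t (cLat n L)) + q.out : colLat ϖ t (cLat n L)) : Fin n → F) =
        ((q.out : colLat ϖ t (cLat n L)) : Fin n → F) - z₀ := by
      rw [AddSubgroup.coe_add, AddSubgroup.coe_neg]; abel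
    rw [e]; exact hw

/-- **The projector recursion** `e^{(s)}_{ϖ^L 𝒪^s, ψ_{2L}(z_{s-1})} (iterAvg s y) = iterAvg (s+1) y` (`s < n`): the
column projector of `WhittakerColumnProjectors` applied to the iterated average is the next iterated average
(entries are copied, `cpair_neg_mul_congChar_inv`, and `R_s` enumerates the quotient lattice). [folklore] -/
theorem proj_iterAvg [Finite 𝓀[F]] (hϖ : IsUniformizingElement ϖ) (hψ : ∀ c ∈ 𝒪[F], ψ c = 1)
    (hL : 1 ≤ L) (h2L : 2 * L ≤ L₀)
    (hR : ∀ t, ∀ z ∈ R t, z ∈ colLat ϖ t (cLat n L))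
    (hRsep : ∀ t, ∀ z ∈ R t, ∀ z' ∈ R t, z' - z ∈ colLat ϖ t (cLat n L₀) → z = z')
    (hRcov : ∀ t, ∀ w ∈ colLat ϖ t (cLat n L), ∃ z ∈ R t, w - z ∈ colLat ϖ t (cLat n L₀))
    (hy0 : ∀ g ∈ congruenceGL n (valuation F (ϖ ^ L₀)), ρ g y = y) {s : ℕ} (hs : s < n) :
    proj ρ ψ ϖ ⟨s, hs⟩ (cLat n L) (colCharAt ϖ L ⟨s, hs⟩) (iterAvg ϖ L R ρ ψ s y) = iterAvg ϖ L R ρ ψ (s + 1) y := by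
  set t : Fin n := ⟨s, hs⟩ with ht
  have hadm : IsAdm ρ ψ ϖ t (cLat n L) (cLat n L₀) (colCharAt ϖ L t) (iterAvg ϖ L R ρ ψ s y) :=
    isAdm_iterAvg hϖ hL h2L hR hy0 s t
  haveI := hadm.finite hϖ
  letI : Fintype (LQ ϖ t (cLat n L) (cLat n L₀)) := Fintype.ofFinite _
  have hbij := bijective_mk hR hRsep hRcov t
  have hIs : ∀ u ∈ iterReps R s, IsTopLeftNat s ((u : GL (Fin n) F) : Matrix (Fin n) (Fin n) F) :=
    fun u hu => (mem_iterReps hR hu).2.1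
  have hRt : ∀ z ∈ R t, ∀ i : Fin n, ¬ i < t → z i = 0 := fun z hz i hi => (hR t z hz).2 i hi
  have hinj := injOn_colElem_mul (R := R) hs hRt hIs
  have hcard : (Nat.card (LQ ϖ t (cLat n L) (cLat n L₀)) : ℂ) = ((R t).card : ℂ) := by
    rw [← Nat.card_eq_of_bijective _ hbij, Nat.card_eq_fintype_card, Fintype.card_coe]
  have hsum : twSum ρ ψ ϖ t (cLat n L) (cLat n L₀) (colCharAt ϖ L t) (iterAvg ϖ L R ρ ψ s y) =
      ∑ z ∈ R t, cpair ψ (colCharAt ϖ L t) (-z) • ρ (colElem t z) (iterAvg ϖ L R ρ ψ s y) := by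
    rw [twSum_eq_sum_of_bijective hψ hϖ.ne_zero hadm.fix hadm.triv _ hbij, ← Finset.sum_coe_sort (R t)]
  have hterm : ∀ z ∈ R t, cpair ψ (colCharAt ϖ L t) (-z) • ρ (colElem t z) (iterAvg ϖ L R ρ ψ s y) =
      (((iterReps R s).card : ℂ))⁻¹ • ∑ u ∈ iterReps R s,
        (congChar (ψ.mulShift (ϖ ^ (-(2 * L)))) (colElem t z * u))⁻¹ • ρ (colElem t z * u) y := by
    intro z _
    simp only [iterAvg, map_smul, map_sum, Finset.smul_sum, smul_smul]
    refine Finset.sum_congr rfl fun u hu => ?_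
    rw [map_mul, Module.End.mul_apply, ← cpair_neg_mul_congChar_inv (hIs u hu) z]
    congr 1
    ring
  rw [proj_eq_twAvg hϖ hψ hadm, twAvg, hcard, hsum, Finset.sum_congr rfl hterm, ← Finset.smul_sum, smul_smul,
    Finset.sum_comm, iterAvg, iterReps_succ_of_lt hs, Finset.card_image_of_injOn hinj, Finset.card_product,
    Finset.sum_image hinj, Finset.sum_product, Nat.cast_mul, mul_inv, mul_comm (((R t).card : ℂ))⁻¹]

omit [ValuativeRel F] in
/-- `iterReps s` is nonempty when all `R_t` are. [folklore] -/
theorem iterReps_nonempty (hne : ∀ t, (R t).Nonempty) : ∀ s, (iterReps (n := n) R s).Nonempty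
  | 0 => by rw [iterReps_zero]; exact Finset.singleton_nonempty _
  | s + 1 => by
    rcases lt_or_ge s n with hs | hs
    · rw [iterReps_succ_of_lt hs]; exact ((iterReps_nonempty hne s).product (hne _)).image _
    · rw [iterReps_succ_of_le hs]; exact iterReps_nonempty hne s

/-- `|ϖ^{L₀}| ≤ |ϖ^L|²` for `2L ≤ L₀`. [folklore] -/
theorem valuation_zpow_le_mul_self (hϖ : IsUniformizingElement ϖ) (h2L : 2 * L ≤ L₀) :
    valuation F (ϖ ^ L₀) ≤ valuation F (ϖ ^ L) * valuation F (ϖ ^ L) := by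
  rw [valuation_zpow_mul_self hϖ.ne_zero]
  exact valuation_zpow_le_of_le hϖ.ne_zero hϖ.valuation_le_one h2L

/-- **Averaging data**: with any transversal `R_B` of the lower triangular part `K(L)^{(s)} ∩ B⁻` modulo `K(L₀)`,
the products `iterReps s · R_B` are admissible averaging data for `(ρ, ψ_{2L}, |ϖ^L|, |ϖ^{L₀}|, s, y)`. [folklore] -/
theorem isCongAvgData_iterReps (hϖ : IsUniformizingElement ϖ) (hψ : ∀ c ∈ 𝒪[F], ψ c = 1)
    (hL : 1 ≤ L) (h2L : 2 * L ≤ L₀)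
    (hR : ∀ t, ∀ z ∈ R t, z ∈ colLat ϖ t (cLat n L))
    (hRsep : ∀ t, ∀ z ∈ R t, ∀ z' ∈ R t, z' - z ∈ colLat ϖ t (cLat n L₀) → z = z')
    (hRcov : ∀ t, ∀ w ∈ colLat ϖ t (cLat n L), ∃ z ∈ R t, w - z ∈ colLat ϖ t (cLat n L₀))
    (hy0 : ∀ g ∈ congruenceGL n (valuation F (ϖ ^ L₀)), ρ g y = y) (s : ℕ) {R_B : Finset (GL (Fin n) F)}
    (hB : IsLeftTransversal (congruenceTL F n (valuation F (ϖ ^ L)) s ⊓ oppositeParabolicGL F (id : Fin n → Fin n))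
      ((congruenceTL F n (valuation F (ϖ ^ L)) s ⊓ oppositeParabolicGL F (id : Fin n → Fin n)) ⊓
        congruenceGL n (valuation F (ϖ ^ L₀))) R_B) :
    IsCongAvgData ρ (ψ.mulShift (ϖ ^ (-(2 * L)))) (valuation F (ϖ ^ L)) (valuation F (ϖ ^ L₀)) s
      ((iterReps R s ×ˢ R_B).image fun p => p.1 * p.2) y where
  hγ := valuation_zpow_lt_one hϖ hL
  hγ₀ := valuation_zpow_le_mul_self hϖ h2L
  hχ c hc := mulShift_eq_one_of_le hϖ.ne_zero hψ hc
  trans := isLeftTransversal_image_mul (valuation_zpow_lt_one hϖ hL)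
    ((valuation_zpow_le_mul_self hϖ h2L).trans
      (by simpa using mul_le_mul' (le_refl _) (valuation_zpow_lt_one hϖ hL).le)) s
    (isLeftTransversal_iterReps hϖ hL (by omega) hR hRsep hRcov s) hB
  fix g hg := hy0 g hg.1

/-- **The iterated average is the twisted average over the whole truncated congruence subgroup** `K(L)^{(s)}`
(for `y` fixed by representatives of the lower triangular part). [folklore] -/
theorem iterAvg_eq_congTwAvg (hϖ : IsUniformizingElement ϖ) (hψ : ∀ c ∈ 𝒪[F], ψ c = 1) (hL : 1 ≤ L)
    (hR : ∀ t, ∀ z ∈ R t, z ∈ colLat ϖ t (cLat n L)) (s : ℕ) {R_B : Finset (GL (Fin n) F)}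
    (hB : IsLeftTransversal (congruenceTL F n (valuation F (ϖ ^ L)) s ⊓ oppositeParabolicGL F (id : Fin n → Fin n))
      ((congruenceTL F n (valuation F (ϖ ^ L)) s ⊓ oppositeParabolicGL F (id : Fin n → Fin n)) ⊓
        congruenceGL n (valuation F (ϖ ^ L₀))) R_B)
    (hfixB : ∀ b ∈ R_B, ρ b y = y) :
    iterAvg ϖ L R ρ ψ s y =
      congTwAvg ρ (ψ.mulShift (ϖ ^ (-(2 * L)))) ((iterReps R s ×ˢ R_B).image fun p => p.1 * p.2) y := by
  have hRB : R_B.Nonempty := by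
    obtain ⟨r, ⟨hr, -⟩, -⟩ := hB.existsUnique 1 (Subgroup.one_mem _)
    exact ⟨r, hr⟩
  rw [congTwAvg_eq_unipotent_sum (fun c hc => mulShift_eq_one_of_le hϖ.ne_zero hψ hc)
    (fun u hu => ⟨(iterReps_mem_congruenceTL hϖ hL hR hu).1.1, (iterReps_mem_congruenceTL hϖ hL hR hu).2⟩)
    (fun b hb => ⟨(hB.mem_of_mem b hb).1.1, (hB.mem_of_mem b hb).2⟩) hRB hfixB, iterAvg]

/-- **Equivariance**: `ρ(g) (iterAvg s y) = ψ_{2L}(∑_i g_{i,i+1}) iterAvg s y` for `g ∈ K(L)^{(s)}`. [folklore] -/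
theorem apply_iterAvg [Finite 𝓀[F]] (hϖ : IsUniformizingElement ϖ) (hψ : ∀ c ∈ 𝒪[F], ψ c = 1)
    (hL : 1 ≤ L) (h2L : 2 * L ≤ L₀)
    (hR : ∀ t, ∀ z ∈ R t, z ∈ colLat ϖ t (cLat n L))
    (hRsep : ∀ t, ∀ z ∈ R t, ∀ z' ∈ R t, z' - z ∈ colLat ϖ t (cLat n L₀) → z = z')
    (hRcov : ∀ t, ∀ w ∈ colLat ϖ t (cLat n L), ∃ z ∈ R t, w - z ∈ colLat ϖ t (cLat n L₀))
    (hy0 : ∀ g ∈ congruenceGL n (valuation F (ϖ ^ L₀)), ρ g y = y) (s : ℕ) {R_B : Finset (GL (Fin n) F)}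
    (hB : IsLeftTransversal (congruenceTL F n (valuation F (ϖ ^ L)) s ⊓ oppositeParabolicGL F (id : Fin n → Fin n))
      ((congruenceTL F n (valuation F (ϖ ^ L)) s ⊓ oppositeParabolicGL F (id : Fin n → Fin n)) ⊓
        congruenceGL n (valuation F (ϖ ^ L₀))) R_B)
    (hfixB : ∀ b ∈ R_B, ρ b y = y) {g : GL (Fin n) F} (hg : g ∈ congruenceTL F n (valuation F (ϖ ^ L)) s) :
    ρ g (iterAvg ϖ L R ρ ψ s y) = congChar (ψ.mulShift (ϖ ^ (-(2 * L)))) g • iterAvg ϖ L R ρ ψ s y := by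
  rw [iterAvg_eq_congTwAvg hϖ hψ hL hR s hB hfixB]
  exact (isCongAvgData_iterReps hϖ hψ hL h2L hR hRsep hRcov hy0 s hB).apply_congTwAvg hg

/-- **The level of the iterated average**: `iterAvg s y` is fixed by `K(2L)^{(s)}`. [folklore] -/
theorem apply_iterAvg_eq_self [Finite 𝓀[F]] (hϖ : IsUniformizingElement ϖ) (hψ : ∀ c ∈ 𝒪[F], ψ c = 1)
    (hL : 1 ≤ L) (h2L : 2 * L ≤ L₀)
    (hR : ∀ t, ∀ z ∈ R t, z ∈ colLat ϖ t (cLat n L))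
    (hRsep : ∀ t, ∀ z ∈ R t, ∀ z' ∈ R t, z' - z ∈ colLat ϖ t (cLat n L₀) → z = z')
    (hRcov : ∀ t, ∀ w ∈ colLat ϖ t (cLat n L), ∃ z ∈ R t, w - z ∈ colLat ϖ t (cLat n L₀))
    (hy0 : ∀ g ∈ congruenceGL n (valuation F (ϖ ^ L₀)), ρ g y = y) (s : ℕ) {R_B : Finset (GL (Fin n) F)}
    (hB : IsLeftTransversal (congruenceTL F n (valuation F (ϖ ^ L)) s ⊓ oppositeParabolicGL F (id : Fin n → Fin n))
      ((congruenceTL F n (valuation F (ϖ ^ L)) s ⊓ oppositeParabolicGL F (id : Fin n → Fin n)) ⊓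
        congruenceGL n (valuation F (ϖ ^ L₀))) R_B)
    (hfixB : ∀ b ∈ R_B, ρ b y = y) {g : GL (Fin n) F}
    (hg : g ∈ congruenceTL F n (valuation F (ϖ ^ (2 * L))) s) :
    ρ g (iterAvg ϖ L R ρ ψ s y) = iterAvg ϖ L R ρ ψ s y := by
  rw [iterAvg_eq_congTwAvg hϖ hψ hL hR s hB hfixB]
  exact (isCongAvgData_iterReps hϖ hψ hL h2L hR hRsep hRcov hy0 s hB).apply_congTwAvg_eq_self
    (le_of_eq (valuation_zpow_mul_self hϖ.ne_zero).symm) hg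

/-- **Lower triangular elements of `K(L)^{(s)}` fix the iterated average.** [folklore] -/
theorem apply_iterAvg_eq_self_of_lower [Finite 𝓀[F]] (hϖ : IsUniformizingElement ϖ) (hψ : ∀ c ∈ 𝒪[F], ψ c = 1)
    (hL : 1 ≤ L) (h2L : 2 * L ≤ L₀)
    (hR : ∀ t, ∀ z ∈ R t, z ∈ colLat ϖ t (cLat n L))
    (hRsep : ∀ t, ∀ z ∈ R t, ∀ z' ∈ R t, z' - z ∈ colLat ϖ t (cLat n L₀) → z = z')
    (hRcov : ∀ t, ∀ w ∈ colLat ϖ t (cLat n L), ∃ z ∈ R t, w - z ∈ colLat ϖ t (cLat n L₀))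
    (hy0 : ∀ g ∈ congruenceGL n (valuation F (ϖ ^ L₀)), ρ g y = y) (s : ℕ) {R_B : Finset (GL (Fin n) F)}
    (hB : IsLeftTransversal (congruenceTL F n (valuation F (ϖ ^ L)) s ⊓ oppositeParabolicGL F (id : Fin n → Fin n))
      ((congruenceTL F n (valuation F (ϖ ^ L)) s ⊓ oppositeParabolicGL F (id : Fin n → Fin n)) ⊓
        congruenceGL n (valuation F (ϖ ^ L₀))) R_B)
    (hfixB : ∀ b ∈ R_B, ρ b y = y) {b : GL (Fin n) F}
    (hb : b ∈ congruenceTL F n (valuation F (ϖ ^ L)) s) (hbl : b ∈ oppositeParabolicGL F (id : Fin n → Fin n)) :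
    ρ b (iterAvg ϖ L R ρ ψ s y) = iterAvg ϖ L R ρ ψ s y := by
  rw [iterAvg_eq_congTwAvg hϖ hψ hL hR s hB hfixB]
  exact (isCongAvgData_iterReps hϖ hψ hL h2L hR hRsep hRcov hy0 s hB).apply_congTwAvg_eq_self_of_lower hb hbl

/-- **Whittaker functionals see through the iterated average**: `Λ(iterAvg s y) = Λ(y)` for every
`ψ_{2L}`-Whittaker functional `Λ` (the representatives are unipotent). [folklore] -/
theorem whittaker_iterAvg (hϖ : IsUniformizingElement ϖ) (hL : 1 ≤ L)
    (hR : ∀ t, ∀ z ∈ R t, z ∈ colLat ϖ t (cLat n L))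
    (hRcov : ∀ t, ∀ w ∈ colLat ϖ t (cLat n L), ∃ z ∈ R t, w - z ∈ colLat ϖ t (cLat n L₀))
    (s : ℕ) (y : V) {Λ : Module.Dual ℂ V}
    (hΛ : Λ ∈ whittakerFunctionals ρ (ψ.mulShift (ϖ ^ (-(2 * L))))) : Λ (iterAvg ϖ L R ρ ψ s y) = Λ y := by
  have hne := iterReps_nonempty (R := R) (fun t => by
    obtain ⟨z, hz, -⟩ := hRcov t 0 (AddSubgroup.zero_mem _)
    exact ⟨z, hz⟩) s
  rw [iterAvg, map_smul, map_sum]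
  have : ∀ u ∈ iterReps R s, Λ ((congChar (ψ.mulShift (ϖ ^ (-(2 * L)))) u)⁻¹ • ρ u y) = Λ y := by
    intro u hu
    have hU := (iterReps_mem_congruenceTL hϖ hL hR hu).2
    rw [map_smul, smul_eq_mul,
      show ρ u y = ρ ((⟨u, hU⟩ : ↥(upperUnitriangular (Fin n) F)) : GL (Fin n) F) y from rfl,
      (mem_whittakerFunctionals_iff Λ).1 hΛ, ← congChar_coe_upperUnitriangular, ← mul_assoc, inv_mul_cancel₀
        (congChar_ne_zero _ u), one_mul]
  rw [Finset.sum_congr rfl this, Finset.sum_const, ← Nat.cast_smul_eq_nsmul ℂ, smul_smul,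
    inv_mul_cancel₀ (Nat.cast_ne_zero.2 (Finset.card_pos.2 hne).ne'), one_smul]

end Recursion


end WhittakerBessel

end Literature.NumberTheory.Automorphic
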